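import Literature.Probability.Percolation.SetClusterExploration
import HarnessLib

/-!
# `NoHeavyLowerTail` (stmt-CriticalPhenomena-4575) — Lemma (★_N) of the conditioned covariance transfer COV(τ),
# finitary "hybrid" form along the full exploration of the cluster of the source set `N`

Support file (`--supports stmt-CriticalPhenomena-4575`), prover `prim-ineq-gen-6` (gen 6).  No definitions, no named
facts, no sorries.  Part of the agreed Lean split of prim-hp-8's refereed proof of COV(τ) (= png-lead's CCT₁;
memo run/shared/lean/prim/prim-hp-8/COV-TAU-PROOF.md §3): hp-4 = Lemma A2, ineq-gen-6 = Lemma (★_N), gen-induct = assembly.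

Setting (finitary, the `DecisionTree`/`PrW` framework of Gladkov's decision trees): edges `D`, weights `p ∈ [0,1]^D`,
configurations `K ⊆ D` with product weight `wtW D p K`; an OWNER `x`, an observer `v`, a SOURCE SET `N`; the full
exploration of the open cluster `C_N` (`SetClusterExploration`, revealed set `S_N(K)` = all edges of `D` meeting `C_N(K)`),
the hybrid `K →_{S_N(K)} C₂` ("resample outside the explored cluster") and the conditional probabilities
`P(Z | 𝓕_N)(K) = condSumW D p S_N Z K`.  For an up-closed event `X` decided by the cluster of `x` (hypothesis `hXrev`:
on `{x ∈ C_N}` the explored data decide `X`) — e.g. `X = {Ψ(C_x) ≥ t}` — put `V_x = {x ↔ v}`, `V_N = {v ↔ N}`,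
`B_G = P(X ∩ V_x) − P(X)P(V_x) = Cov(1_X, 1_{v∈C_x})` and

  `Y^hyb(N) = Σ_{K : x ∉ C_N(K)} w(K) · [P(X ∩ V_x | 𝓕_N)(K) − P(X | 𝓕_N)(K) · P(V_x | 𝓕_N)(K)]`

(= hp-8's `Y(N) = E[B(C_N); x ∉ C_N]` written with the hybrid, which from outside `C_N` is percolation on `G ∖ C_N`,
`SetClusterExploration.reachable_splice_iff_of_not_mem_reached`).  THEOREM (`starN_hybrid`; indicators, so monotone `Ψ` by layer cake):

  `P(v ↮ x) · Y^hyb(N) ≤ P(v ↮ x, v ↮ N) · B_G`,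

given the two-cluster vdBHK inequality `P(X, v↮x, v↔N)·P(v↮x) ≤ P(v↮x, v↔N)·P(X, v↮x)` (Thm 1.4 of
van den Berg–Häggström–Kahn 2006 for `1_X` ↑ in `C_x` and `1{v↔N}` ↑ in `C_v` given `v ↮ x`; tree:
`BHK2006_twoSetConditionalAssociation.negCorrelation`, supplied by the caller in this finitary form as `hBHK`).
PROOF (hp-8 §3): law of total covariance `B_G = Y^hyb + Cov(ĝ, ĥ)` (on `{x ∈ C_N}` the explored data decide everything),
the identity `Cov(ĝ, ĥ) = Cov(ĝ, 1_U) − Cov(1_X, 1_{V_N ∖ V_x})`, `U = V_x ∪ V_N`, decision-tree Harris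
`Cov(ĝ, 1_U) ≥ 0` (`SetClusterExploration.PrW_mul_PrW_le_sum_condSumW_mul`, Gladkov Thm 3.2), and `hBHK`.
[cite: Gladkov2024, Thm. 3.2 (p. 4), Lemma 3.1] [cite: VandenbergHaggstromKahn2005, Thm. 1.4 (p. 7), eq. (6)]
-/

noncomputable section

open Classical

namespace Summit.CriticalPhenomena.PercolationContinuityZ3.Theorems

namespace CovTauStarN

open Finset Literature.Probability.Percolation Literature.Probability.Percolation.DecisionTree
open Literature.Probability.Percolation.SetClusterExploration
open Literature.Probability.Percolation.TargetExploration (St)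

variable {V : Type*} [Fintype V] [DecidableEq V]
variable {D : Finset (Sym2 V)} {N : Finset V} {p : Sym2 V → ℝ}

/-! ### The cluster of `x` inside the explored cluster is decided by the explored data -/

/-- For `x` in the explored cluster `C_N(C₁)`, connectivity from `x` is the same in the hybrid
`C₁ →_{S_N(C₁)} C₂` as in `C₁`: every edge of `D` meeting `C_N` is revealed, and `C_x ⊆ C_N`. [this work] -/
theorem reachable_splice_iff_of_mem_reached {C₁ C₂ : Finset (Sym2 V)} {x z : V}
    (hx : x ∈ reached D N C₁) :
    (openGraph (↑(splice (revealedAt D N C₁) C₁ C₂ ∩ D) : Set (Sym2 V))).Reachable x z ↔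
      (openGraph (↑(C₁ ∩ D) : Set (Sym2 V))).Reachable x z := by
  -- a walk from a reached vertex, in either configuration, stays in the reached set and uses only
  -- revealed edges, on which the two configurations agree
  have key : ∀ (K K' : Finset (Sym2 V)), reached D N K' = reached D N K →
      (∀ e ∈ revealedAt D N K, (e ∈ K ↔ e ∈ K')) →
      ∀ z, (openGraph (↑(K ∩ D) : Set (Sym2 V))).Reachable x z →
        x ∈ reached D N K → (openGraph (↑(K' ∩ D) : Set (Sym2 V))).Reachable x z := by
    intro K K' hRK hagree z hz hxK
    obtain ⟨q⟩ := hz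
    -- induction along the walk, keeping the current vertex reached
    suffices h : ∀ (a b : V) (q : (openGraph (↑(K ∩ D) : Set (Sym2 V))).Walk a b), a ∈ reached D N K →
        (openGraph (↑(K' ∩ D) : Set (Sym2 V))).Reachable a b from h x z q hxK
    intro a b q
    induction q with
    | nil => intro _; exact SimpleGraph.Reachable.refl _
    | @cons a b c hadj q ih =>
        intro ha
        rw [openGraph_adj] at hadj
        obtain ⟨hab, hne⟩ := hadj
        rw [mem_coe, mem_inter] at hab
        have heS : s(a, b) ∈ revealedAt D N K :=
          mem_revealedAt_iff.2 ⟨hab.2, a, ha, Sym2.mem_mk_left a b⟩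
        have hb : b ∈ reached D N K := mem_reached_of_mem_revealedAt heS hab.1 (Sym2.mem_mk_right a b)
        have hadj' : (openGraph (↑(K' ∩ D) : Set (Sym2 V))).Adj a b := by
          rw [openGraph_adj]
          exact ⟨mem_coe.2 (mem_inter.2 ⟨(hagree _ heS).1 hab.1, hab.2⟩), hne⟩
        exact hadj'.reachable.trans (ih hb)
  constructor
  · intro h
    have hx' : x ∈ reached D N (splice (revealedAt D N C₁) C₁ C₂) := by rwa [reached_splice]
    refine key _ _ (reached_splice C₁ C₂).symm ?_ z h hx'
    intro e he
    rw [revealedAt_splice] at he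
    exact splice_agree _ C₁ C₂ e he
  · intro h
    refine key _ _ (reached_splice C₁ C₂) ?_ z h hx
    intro e he
    exact (splice_agree _ C₁ C₂ e he).symm

/-- `reached` is monotone in the configuration. [this work] -/
theorem reached_mono {K K' : Finset (Sym2 V)} (h : K ⊆ K') : reached D N K ⊆ reached D N K' := by
  intro v hv
  rw [mem_reached_iff] at hv ⊢
  obtain ⟨s, hs, hsv⟩ := hv
  exact ⟨s, hs, hsv.mono (openGraph_mono (coe_subset.2 (inter_subset_inter h subset_rfl)))⟩

/-- If `v` is in the explored cluster and joined to `x`, then `x` is in the explored cluster. [this work] -/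
theorem mem_reached_of_reachable {K : Finset (Sym2 V)} {x v : V} (hv : v ∈ reached D N K)
    (hxv : (openGraph (↑(K ∩ D) : Set (Sym2 V))).Reachable x v) : x ∈ reached D N K := by
  rw [mem_reached_iff] at hv ⊢
  obtain ⟨s, hs, hsv⟩ := hv
  exact ⟨s, hs, hsv.trans hxv.symm⟩

/-! ### Tower identities for events decided by the explored data -/

/-- An event `E` is DECIDED by the exploration of `C_N` when the hybrid lies in `E` iff `C₁` does. For such `E`
and any `Z`: `Σ_K w(K) 1_E(K) P(Z | 𝓕_N)(K) = P(E ∩ Z)` (tower property + law of the hybrid). [this work] -/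
theorem sum_wtW_ind_mul_condSumW_of_decided {E : Set (Finset (Sym2 V))}
    (hE : ∀ K C₂ : Finset (Sym2 V), splice (revealedAt D N K) K C₂ ∈ E ↔ K ∈ E) (Z : Set (Finset (Sym2 V))) :
    ∑ K ∈ D.powerset, wtW D p K * ind E K * condSumW D p (revealedAt D N) Z K = PrW D p (E ∩ Z) := by
  rw [← sum_wtW_mul_condSumW D N p (E ∩ Z)]
  refine Finset.sum_congr rfl fun K _ => ?_
  unfold condSumW
  rw [Finset.mul_sum, Finset.mul_sum]
  refine Finset.sum_congr rfl fun C₂ _ => ?_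
  have : ind E K * ind Z (splice (revealedAt D N K) K C₂) = ind (E ∩ Z) (splice (revealedAt D N K) K C₂) := by
    by_cases h1 : K ∈ E
    · have h1' := (hE K C₂).2 h1
      by_cases h2 : splice (revealedAt D N K) K C₂ ∈ Z
      · rw [ind_of_mem h1, ind_of_mem h2, ind_of_mem (show _ ∈ E ∩ Z from ⟨h1', h2⟩)]; ring
      · rw [ind_of_not_mem h2, ind_of_not_mem (show _ ∉ E ∩ Z from fun h => h2 h.2)]; ring
    · rw [ind_of_not_mem h1, ind_of_not_mem (show _ ∉ E ∩ Z from fun h => h1 ((hE K C₂).1 h.1))]; ring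
  calc wtW D p K * ind E K * (wtW D p C₂ * ind Z (splice (revealedAt D N K) K C₂))
      = wtW D p K * wtW D p C₂ * (ind E K * ind Z (splice (revealedAt D N K) K C₂)) := by ring
    _ = wtW D p K * (wtW D p C₂ * ind (E ∩ Z) (splice (revealedAt D N K) K C₂)) := by rw [this]; ring

/-- If at the configuration `K` the event `Z` is decided (the hybrid lies in `Z` iff `K` does, for every second
configuration), then `P(Z | 𝓕_N)(K) = 1_Z(K)`. [this work] -/
theorem condSumW_eq_ind_of_decided {Z : Set (Finset (Sym2 V))} {K : Finset (Sym2 V)}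
    (hZ : ∀ C₂ : Finset (Sym2 V), splice (revealedAt D N K) K C₂ ∈ Z ↔ K ∈ Z) :
    condSumW D p (revealedAt D N) Z K = ind Z K := by
  unfold condSumW
  have : ∀ C₂ ∈ D.powerset, wtW D p C₂ * ind Z (splice (revealedAt D N K) K C₂) = wtW D p C₂ * ind Z K := by
    intro C₂ _
    by_cases h : K ∈ Z
    · rw [ind_of_mem h, ind_of_mem ((hZ C₂).2 h)]
    · rw [ind_of_not_mem h, ind_of_not_mem (fun h' => h ((hZ C₂).1 h'))]
  rw [Finset.sum_congr rfl this, ← Finset.sum_mul, sum_wtW, one_mul]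

/-! ### Lemma (★_N), hybrid form -/

/-- **Lemma (★_N) of the conditioned covariance transfer, finitary hybrid form** (see the module docstring):
with `V_x = {x ↔ v}`, `V_N = {v ↔ N}` (through `K ∩ D`), `X` up-closed and decided by the explored data on `{x ∈ C_N}`,
`Y^hyb(N) = Σ_{K : x ∉ C_N(K)} w(K)[P(X∩V_x|𝓕_N) − P(X|𝓕_N)P(V_x|𝓕_N)](K)` and `B_G = P(X ∩ V_x) − P(X)P(V_x)`:
`P(V_xᶜ) · Y^hyb(N) ≤ P(V_xᶜ ∩ V_Nᶜ) · B_G`, given the two-cluster vdBHK inequality `hBHK`.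
[cite: Gladkov2024, Thm. 3.2 (p. 4)] [cite: VandenbergHaggstromKahn2005, Thm. 1.4 (p. 7)] -/
theorem starN_hybrid (hp0 : ∀ e, 0 ≤ p e) (hp1 : ∀ e, p e ≤ 1) (x v : V)
    {X : Set (Finset (Sym2 V))} (hX : IsUpperSet X)
    (hXrev : ∀ K C₂ : Finset (Sym2 V), x ∈ reached D N K → (splice (revealedAt D N K) K C₂ ∈ X ↔ K ∈ X))
    (hBHK :
      PrW D p (X ∩ {K | ¬ (openGraph (↑(K ∩ D) : Set (Sym2 V))).Reachable x v} ∩ {K | v ∈ reached D N K}) *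
          PrW D p {K | ¬ (openGraph (↑(K ∩ D) : Set (Sym2 V))).Reachable x v} ≤
        PrW D p ({K | ¬ (openGraph (↑(K ∩ D) : Set (Sym2 V))).Reachable x v} ∩ {K | v ∈ reached D N K}) *
          PrW D p (X ∩ {K | ¬ (openGraph (↑(K ∩ D) : Set (Sym2 V))).Reachable x v})) :
    PrW D p {K | ¬ (openGraph (↑(K ∩ D) : Set (Sym2 V))).Reachable x v} *
        (∑ K ∈ D.powerset, wtW D p K * ind {K | x ∉ reached D N K} K *
          (condSumW D p (revealedAt D N) (X ∩ {K | (openGraph (↑(K ∩ D) : Set (Sym2 V))).Reachable x v}) K -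
            condSumW D p (revealedAt D N) X K *
              condSumW D p (revealedAt D N) {K | (openGraph (↑(K ∩ D) : Set (Sym2 V))).Reachable x v} K)) ≤
      PrW D p ({K | ¬ (openGraph (↑(K ∩ D) : Set (Sym2 V))).Reachable x v} ∩ {K | v ∉ reached D N K}) *
        (PrW D p (X ∩ {K | (openGraph (↑(K ∩ D) : Set (Sym2 V))).Reachable x v}) -
          PrW D p X * PrW D p {K | (openGraph (↑(K ∩ D) : Set (Sym2 V))).Reachable x v}) := by
  -- names
  set S := revealedAt D N with hS
  set Vx : Set (Finset (Sym2 V)) := {K | (openGraph (↑(K ∩ D) : Set (Sym2 V))).Reachable x v} with hVx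
  set VN : Set (Finset (Sym2 V)) := {K | v ∈ reached D N K} with hVN
  set In : Set (Finset (Sym2 V)) := {K | x ∈ reached D N K} with hIn
  set cp := fun (Z : Set (Finset (Sym2 V))) (K : Finset (Sym2 V)) => condSumW D p S Z K with hcp
  have hVxc : {K : Finset (Sym2 V) | ¬ (openGraph (↑(K ∩ D) : Set (Sym2 V))).Reachable x v} = Vxᶜ := rfl
  have hVNc : {K : Finset (Sym2 V) | v ∉ reached D N K} = VNᶜ := rfl
  have hInc : {K : Finset (Sym2 V) | x ∉ reached D N K} = Inᶜ := rfl
  rw [hVxc, hVNc, hInc]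
  -- (0) basic decided / up-set facts
  have hVN_dec : ∀ K C₂ : Finset (Sym2 V), splice (S K) K C₂ ∈ VN ↔ K ∈ VN := by
    intro K C₂; simp only [hVN, Set.mem_setOf_eq, hS, reached_splice]
  have hIn_dec : ∀ K C₂ : Finset (Sym2 V), splice (S K) K C₂ ∈ In ↔ K ∈ In := by
    intro K C₂; simp only [hIn, Set.mem_setOf_eq, hS, reached_splice]
  have hVx_dec : ∀ K C₂ : Finset (Sym2 V), K ∈ In → (splice (S K) K C₂ ∈ Vx ↔ K ∈ Vx) := by
    intro K C₂ hK
    simp only [hVx, Set.mem_setOf_eq, hS]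
    exact reachable_splice_iff_of_mem_reached hK
  -- `V_x ∩ V_N = V_x ∩ In` and it is decided
  have hVxVN : Vx ∩ VN = Vx ∩ In := by
    ext K
    simp only [Set.mem_inter_iff, hVx, hVN, hIn, Set.mem_setOf_eq]
    constructor
    · rintro ⟨h1, h2⟩; exact ⟨h1, mem_reached_of_reachable h2 h1⟩
    · rintro ⟨h1, h2⟩
      refine ⟨h1, ?_⟩
      rw [mem_reached_iff] at h2 ⊢
      obtain ⟨s, hs, hsx⟩ := h2
      exact ⟨s, hs, hsx.trans h1⟩
  have hVxIn_dec : ∀ K C₂ : Finset (Sym2 V), splice (S K) K C₂ ∈ Vx ∩ In ↔ K ∈ Vx ∩ In := by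
    intro K C₂
    by_cases hK : K ∈ In
    · simp only [Set.mem_inter_iff, hVx_dec K C₂ hK, hIn_dec K C₂]
    · constructor
      · rintro ⟨-, h2⟩; exact absurd ((hIn_dec K C₂).1 h2) hK
      · rintro ⟨-, h2⟩; exact absurd h2 hK
  have hVxUp : IsUpperSet Vx := by
    intro K K' hKK' hK
    exact hK.mono (openGraph_mono (coe_subset.2 (inter_subset_inter hKK' subset_rfl)))
  have hVNUp : IsUpperSet VN := fun K K' hKK' hK => reached_mono hKK' hK
  have hUUp : IsUpperSet (Vx ∪ VN) := hVxUp.union hVNUp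
  -- (1) law of total covariance: on `In` everything is decided
  have hdec_on_In : ∀ K ∈ D.powerset, ind In K *
      (cp (X ∩ Vx) K - cp X K * cp Vx K) = 0 := by
    intro K _
    by_cases hK : K ∈ In
    · have h1 : cp X K = ind X K := condSumW_eq_ind_of_decided (fun C₂ => hXrev K C₂ hK)
      have h2 : cp Vx K = ind Vx K := condSumW_eq_ind_of_decided (fun C₂ => hVx_dec K C₂ hK)
      have h3 : cp (X ∩ Vx) K = ind (X ∩ Vx) K :=
        condSumW_eq_ind_of_decided (fun C₂ => and_congr (hXrev K C₂ hK) (hVx_dec K C₂ hK))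
      have h4 : ind (X ∩ Vx) K = ind X K * ind Vx K := by
        by_cases ha : K ∈ X
        · by_cases hb : K ∈ Vx
          · rw [ind_of_mem ha, ind_of_mem hb, ind_of_mem (show K ∈ X ∩ Vx from ⟨ha, hb⟩)]; ring
          · rw [ind_of_not_mem hb, ind_of_not_mem (show K ∉ X ∩ Vx from fun h => hb h.2)]; ring
        · rw [ind_of_not_mem ha, ind_of_not_mem (show K ∉ X ∩ Vx from fun h => ha h.1)]; ring
      rw [h1, h2, h3, h4]
      ring
    · rw [ind_of_not_mem hK]; ring
  -- total: Σ w [cp(X∩Vx) − cpX cpVx] = Yhyb + 0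
  have htot : ∑ K ∈ D.powerset, wtW D p K * (cp (X ∩ Vx) K - cp X K * cp Vx K) =
      ∑ K ∈ D.powerset, wtW D p K * ind Inᶜ K * (cp (X ∩ Vx) K - cp X K * cp Vx K) := by
    refine Finset.sum_congr rfl fun K hK => ?_
    have hsplit : ind Inᶜ K = 1 - ind In K := by
      by_cases h : K ∈ In
      · rw [ind_of_mem h, ind_of_not_mem (show K ∉ Inᶜ from fun h' => h' h)]; ring
      · rw [ind_of_not_mem h, ind_of_mem (show K ∈ Inᶜ from h)]; ring
    rw [hsplit]
    have h0 := hdec_on_In K hK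
    have : wtW D p K * (1 - ind In K) * (cp (X ∩ Vx) K - cp X K * cp Vx K) =
        wtW D p K * (cp (X ∩ Vx) K - cp X K * cp Vx K) -
          wtW D p K * (ind In K * (cp (X ∩ Vx) K - cp X K * cp Vx K)) := by ring
    rw [this, h0, mul_zero, sub_zero]
  -- B_G = Σ w cp(X∩Vx) − PX PVx  and  Σ w cp(X∩Vx) = P(X∩Vx)
  have hT1 : ∑ K ∈ D.powerset, wtW D p K * cp (X ∩ Vx) K = PrW D p (X ∩ Vx) := sum_wtW_mul_condSumW D N p _
  -- CovCE pieces: Σ w cpX cpVx = Σ w ind Vx cpX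
  have hT2 : ∑ K ∈ D.powerset, wtW D p K * ind Vx K * cp X K =
      ∑ K ∈ D.powerset, wtW D p K * cp Vx K * cp X K := sum_wtW_ind_mul_condSumW D N p Vx X
  -- split ind Vx = ind (Vx ∩ In) + ind (Vx \ In) ... and tower on the decided event Vx ∩ In
  have hT3 : ∑ K ∈ D.powerset, wtW D p K * ind (Vx ∩ In) K * cp X K = PrW D p ((Vx ∩ In) ∩ X) :=
    sum_wtW_ind_mul_condSumW_of_decided hVxIn_dec X
  have hT4 : ∑ K ∈ D.powerset, wtW D p K * ind VN K * cp X K = PrW D p (VN ∩ X) :=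
    sum_wtW_ind_mul_condSumW_of_decided hVN_dec X
  -- TH: Σ w ind U cp X ≥ PU PX
  have hTH : PrW D p (Vx ∪ VN) * PrW D p X ≤
      ∑ K ∈ D.powerset, wtW D p K * ind (Vx ∪ VN) K * cp X K := by
    rw [sum_wtW_ind_mul_condSumW D N p (Vx ∪ VN) X]
    exact PrW_mul_PrW_le_sum_condSumW_mul D N hp0 hp1 hUUp hX
  -- pointwise indicator algebra: ind U = ind VN + ind (Vx ∩ Inᶜ), ind Vx = ind (Vx∩In) + ind (Vx ∩ Inᶜ)
  have hIn_of : ∀ K, K ∈ Vx → K ∈ VN → K ∈ In := fun K h1 h2 => by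
    have hk : K ∈ Vx ∩ VN := ⟨h1, h2⟩
    rw [hVxVN] at hk
    exact hk.2
  have hVN_of : ∀ K, K ∈ Vx → K ∈ In → K ∈ VN := fun K h1 h2 => by
    have hk : K ∈ Vx ∩ In := ⟨h1, h2⟩
    rw [← hVxVN] at hk
    exact hk.2
  have hindU : ∀ K, ind (Vx ∪ VN) K = ind VN K + ind (Vx ∩ Inᶜ) K := by
    intro K
    by_cases h1 : K ∈ VN
    · have : K ∉ Vx ∩ Inᶜ := fun h => h.2 (hIn_of K h.1 h1)
      rw [ind_of_mem (Set.mem_union_right _ h1), ind_of_mem h1, ind_of_not_mem this]; ring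
    · by_cases h2 : K ∈ Vx
      · have : K ∈ Vx ∩ Inᶜ := ⟨h2, fun h3 => h1 (hVN_of K h2 h3)⟩
        rw [ind_of_mem (Set.mem_union_left _ h2), ind_of_not_mem h1, ind_of_mem this]; ring
      · have : K ∉ Vx ∩ Inᶜ := fun h => h2 h.1
        have hU : K ∉ Vx ∪ VN := by
          rintro (h | h)
          · exact h2 h
          · exact h1 h
        rw [ind_of_not_mem hU, ind_of_not_mem h1, ind_of_not_mem this]
        ring
  have hindVx : ∀ K, ind Vx K = ind (Vx ∩ In) K + ind (Vx ∩ Inᶜ) K := by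
    intro K
    by_cases h2 : K ∈ Vx
    · by_cases h3 : K ∈ In
      · rw [ind_of_mem h2, ind_of_mem (show K ∈ Vx ∩ In from ⟨h2, h3⟩),
          ind_of_not_mem (show K ∉ Vx ∩ Inᶜ from fun h => h.2 h3)]; ring
      · rw [ind_of_mem h2, ind_of_not_mem (show K ∉ Vx ∩ In from fun h => h3 h.2),
          ind_of_mem (show K ∈ Vx ∩ Inᶜ from ⟨h2, h3⟩)]; ring
    · rw [ind_of_not_mem h2, ind_of_not_mem (show K ∉ Vx ∩ In from fun h => h2 h.1),
        ind_of_not_mem (show K ∉ Vx ∩ Inᶜ from fun h => h2 h.1)]; ring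
  -- the common piece
  set R := ∑ K ∈ D.powerset, wtW D p K * ind (Vx ∩ Inᶜ) K * cp X K with hR
  have hU_sum : ∑ K ∈ D.powerset, wtW D p K * ind (Vx ∪ VN) K * cp X K = PrW D p (VN ∩ X) + R := by
    rw [← hT4, hR, ← Finset.sum_add_distrib]
    refine Finset.sum_congr rfl fun K _ => ?_
    rw [hindU K]; ring
  have hVx_sum : ∑ K ∈ D.powerset, wtW D p K * ind Vx K * cp X K = PrW D p ((Vx ∩ In) ∩ X) + R := by
    rw [← hT3, hR, ← Finset.sum_add_distrib]
    refine Finset.sum_congr rfl fun K _ => ?_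
    rw [hindVx K]; ring
  -- measure-theoretic identities for the sets
  have hPU : PrW D p (Vx ∪ VN) = PrW D p Vx + PrW D p (Vxᶜ ∩ VN) := by
    have : Vx ∪ VN = Vx ∪ (Vxᶜ ∩ VN) := by
      ext K; simp only [Set.mem_union, Set.mem_inter_iff, Set.mem_compl_iff]; tauto
    rw [this, PrW_union D p (Set.disjoint_left.2 fun K h1 h2 => h2.1 h1)]
  have hPVxInX : PrW D p ((Vx ∩ In) ∩ X) = PrW D p (VN ∩ X) - PrW D p (Vxᶜ ∩ VN ∩ X) := by
    have hsplit : VN ∩ X = ((Vx ∩ In) ∩ X) ∪ (Vxᶜ ∩ VN ∩ X) := by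
      ext K
      simp only [Set.mem_union, Set.mem_inter_iff, Set.mem_compl_iff]
      constructor
      · rintro ⟨h2, h3⟩
        by_cases h1 : K ∈ Vx
        · exact Or.inl ⟨⟨h1, hIn_of K h1 h2⟩, h3⟩
        · exact Or.inr ⟨⟨h1, h2⟩, h3⟩
      · rintro (⟨⟨h1, h4⟩, h3⟩ | ⟨⟨h1, h2⟩, h3⟩)
        · exact ⟨hVN_of K h1 h4, h3⟩
        · exact ⟨h2, h3⟩
    have hdisj : Disjoint ((Vx ∩ In) ∩ X) (Vxᶜ ∩ VN ∩ X) :=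
      Set.disjoint_left.2 fun K h1 h2 => h2.1.1 h1.1.1
    have := PrW_union D p hdisj
    rw [← hsplit] at this
    linarith
  have hPVxc : PrW D p Vxᶜ = PrW D p (Vxᶜ ∩ VN) + PrW D p (Vxᶜ ∩ VNᶜ) := by
    have : Vxᶜ = (Vxᶜ ∩ VN) ∪ (Vxᶜ ∩ VNᶜ) := by
      ext K; simp only [Set.mem_union, Set.mem_inter_iff, Set.mem_compl_iff]; tauto
    rw [this, PrW_union D p (Set.disjoint_left.2 fun K h1 h2 => h2.2 h1.2), ← this]
  -- nonnegativity facts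
  have hPVxc0 : 0 ≤ PrW D p Vxᶜ := PrW_nonneg D hp0 hp1 _
  -- assemble: write Yhyb via htot, hT1, hT2, hVx_sum
  have hY : ∑ K ∈ D.powerset, wtW D p K * ind Inᶜ K * (cp (X ∩ Vx) K - cp X K * cp Vx K) =
      (PrW D p (X ∩ Vx) - PrW D p X * PrW D p Vx) -
        (PrW D p (VN ∩ X) - PrW D p (Vxᶜ ∩ VN ∩ X) + R - PrW D p X * PrW D p Vx) := by
    rw [← htot]
    have h1 : ∑ K ∈ D.powerset, wtW D p K * (cp (X ∩ Vx) K - cp X K * cp Vx K) =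
        ∑ K ∈ D.powerset, wtW D p K * cp (X ∩ Vx) K -
          ∑ K ∈ D.powerset, wtW D p K * cp Vx K * cp X K := by
      rw [← Finset.sum_sub_distrib]
      refine Finset.sum_congr rfl fun K _ => ?_; ring
    rw [h1, hT1, ← hT2, hVx_sum, hPVxInX]
    ring
  rw [hY]
  -- TH in the form: PU PX ≤ P(VN∩X) + R
  rw [hU_sum] at hTH
  rw [hPU] at hTH
  -- hBHK rewritten with names
  have hB : PrW D p (X ∩ Vxᶜ ∩ VN) * PrW D p Vxᶜ ≤ PrW D p (Vxᶜ ∩ VN) * PrW D p (X ∩ Vxᶜ) := hBHK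
  have hXVxc : PrW D p (X ∩ Vxᶜ) = PrW D p X - PrW D p (X ∩ Vx) := by
    have : X = (X ∩ Vx) ∪ (X ∩ Vxᶜ) := by
      ext K; simp only [Set.mem_union, Set.mem_inter_iff, Set.mem_compl_iff]; tauto
    have hdisj : Disjoint (X ∩ Vx) (X ∩ Vxᶜ) := Set.disjoint_left.2 fun K h1 h2 => h2.2 h1.2
    have := PrW_union D p hdisj
    rw [← ‹X = (X ∩ Vx) ∪ (X ∩ Vxᶜ)›] at this
    linarith
  have hXVxcVN : PrW D p (X ∩ Vxᶜ ∩ VN) = PrW D p (Vxᶜ ∩ VN ∩ X) := by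
    congr 1; ext K; simp only [Set.mem_inter_iff]; tauto
  rw [hXVxc, hXVxcVN] at hB
  -- final real arithmetic
  have hcompl : PrW D p Vx + PrW D p Vxᶜ = 1 := by
    rw [← PrW_union D p (disjoint_compl_right (a := Vx)), Set.union_compl_self, PrW_univ]
  have hdist : (PrW D p Vx + PrW D p (Vxᶜ ∩ VN)) * PrW D p X =
      PrW D p Vx * PrW D p X + PrW D p (Vxᶜ ∩ VN) * PrW D p X := by ring
  have hYle : PrW D p (X ∩ Vx) - PrW D p X * PrW D p Vx -
        (PrW D p (VN ∩ X) - PrW D p (Vxᶜ ∩ VN ∩ X) + R - PrW D p X * PrW D p Vx) ≤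
      (PrW D p (X ∩ Vx) - PrW D p X * PrW D p Vx) + PrW D p (Vxᶜ ∩ VN ∩ X) -
        PrW D p (Vxᶜ ∩ VN) * PrW D p X := by
    linarith [hTH, hdist]
  have h1 := mul_le_mul_of_nonneg_left hYle hPVxc0
  have hkey : PrW D p (Vxᶜ ∩ VN) * PrW D p X * (1 - PrW D p Vxᶜ) =
      PrW D p (Vxᶜ ∩ VN) * PrW D p X * PrW D p Vx := by
    rw [← hcompl]; ring
  have hexp : PrW D p Vxᶜ * ((PrW D p (X ∩ Vx) - PrW D p X * PrW D p Vx) + PrW D p (Vxᶜ ∩ VN ∩ X) -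
        PrW D p (Vxᶜ ∩ VN) * PrW D p X) =
      PrW D p Vxᶜ * (PrW D p (X ∩ Vx) - PrW D p X * PrW D p Vx) + PrW D p (Vxᶜ ∩ VN ∩ X) * PrW D p Vxᶜ -
        PrW D p (Vxᶜ ∩ VN) * PrW D p X + PrW D p (Vxᶜ ∩ VN) * PrW D p X * (1 - PrW D p Vxᶜ) := by ring
  rw [hexp, hkey] at h1
  have hr : PrW D p (Vxᶜ ∩ VNᶜ) = PrW D p Vxᶜ - PrW D p (Vxᶜ ∩ VN) := by linarith [hPVxc]
  have hfin : PrW D p Vxᶜ * (PrW D p (X ∩ Vx) - PrW D p X * PrW D p Vx) + PrW D p (Vxᶜ ∩ VN ∩ X) * PrW D p Vxᶜ -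
        PrW D p (Vxᶜ ∩ VN) * PrW D p X + PrW D p (Vxᶜ ∩ VN) * PrW D p X * PrW D p Vx ≤
      (PrW D p Vxᶜ - PrW D p (Vxᶜ ∩ VN)) * (PrW D p (X ∩ Vx) - PrW D p X * PrW D p Vx) := by
    have hring : (PrW D p Vxᶜ - PrW D p (Vxᶜ ∩ VN)) * (PrW D p (X ∩ Vx) - PrW D p X * PrW D p Vx) =
        PrW D p Vxᶜ * (PrW D p (X ∩ Vx) - PrW D p X * PrW D p Vx) - PrW D p (Vxᶜ ∩ VN) * PrW D p (X ∩ Vx) +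
          PrW D p (Vxᶜ ∩ VN) * PrW D p X * PrW D p Vx := by ring
    have hB' : PrW D p (Vxᶜ ∩ VN ∩ X) * PrW D p Vxᶜ ≤
        PrW D p (Vxᶜ ∩ VN) * PrW D p X - PrW D p (Vxᶜ ∩ VN) * PrW D p (X ∩ Vx) := by
      have : PrW D p (Vxᶜ ∩ VN) * (PrW D p X - PrW D p (X ∩ Vx)) =
          PrW D p (Vxᶜ ∩ VN) * PrW D p X - PrW D p (Vxᶜ ∩ VN) * PrW D p (X ∩ Vx) := by ring
      rw [← this]; exact hB
    rw [hring]
    linarith [hB']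
  rw [hr]
  exact h1.trans hfin

end CovTauStarN

end Summit.CriticalPhenomena.PercolationContinuityZ3.Theorems

end
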